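import Summits.ResolutionOfSingularities.ResolutionOfSingularities.Theorems.EquisingularLiftEquisingularLiftBertiniBaseCurveFibre
import HarnessLib

/-!
# Crux `EquisingularLift` (stmt-ResolutionOfSingularities-15660), line `Sketch`:
# the dimension count for Bertini with a base curve

[OURS · L1 W4.5b] Support file for the registered stub `stub_bertiniWithBaseCurve` of
`Cruxes/EquisingularLift/Lines/Sketch.lean` (idea card `linked-ci-centres`, lemma 1); NOT a statement
of any manuscript.

Setting of `Literature/AlgebraicGeometry/Resolution/BertiniAffine.lean` (Hartshorne II.8.18 in affine
local-algebra form): `A` a regular algebra of finite type over an algebraically closed field `k`,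
`u : ι → A` finitely many functions, `s_t = Σ tⱼ uⱼ`, `B = A[a]/(Σ aⱼ uⱼ)` the incidence ring over the
parameter ring `k[a]`, `𝔔_{t,𝔪}` its closed points. The tree's dimension count
(`BertiniAffine.under_paramRing_ne_bot`) assumes that `t ↦ s_t mod 𝔪²` is SURJECTIVE at every closed
point `𝔪`. Here the linear system may have a BASE CURVE `Σ = V(𝔭)` (`dim A/𝔭 ≤ 1`): off `Σ` the
map `t ↦ s_t mod 𝔪²` is surjective, on `Σ` its range has rank `≥ 2`. The count still shows that no
component of the bad locus `{(t, 𝔪) | s_t ∈ 𝔪²}` dominates the parameter space: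

* the fibre count at one bad closed point (`height_map_mk_fibre_add_finrank_le`) is in the sibling file
  `EquisingularLiftEquisingularLiftBertiniBaseCurveFibre.lean`;
* `under_paramRing_ne_bot_baseCurve` — the count with a base curve: a prime `𝔔 ⊆ B` all of whose
  closed points are bad meets `k[a] ∖ 0`. If some closed point of `V(𝔔)` lies off `Σ`, this is the
  tree's count at that point; otherwise `𝔭A[a] ⊆ 𝔔̃` (Jacobson), and Matsumura 15.1 for
  `A/𝔭 → A[a]/𝔔̃` bounds `dim A[a]/𝔔̃ ≤ dim A/𝔭 + (|ι| - 2) < |ι|`.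

References: Hartshorne, *Algebraic Geometry*, II Thm. 8.18 (proof); Matsumura, *Commutative Ring
Theory*, Thm. 15.1; the base-locus variant is classical (Altman–Kleiman, *Bertini theorems for
hypersurface sections containing a subscheme*, Comm. Algebra 7 (1979)).
-/

set_option linter.dupNamespace false -- mandated namespace `Summit.<Summit>.<Problem>` of this single-conjunct summit

noncomputable section

open IsLocalRing MvPolynomial

universe u v

namespace Summit.ResolutionOfSingularities.ResolutionOfSingularities.Cruxes.EquisingularLift.StrataSplit

open Literature.AlgebraicGeometry.Resolution Literature.AlgebraicGeometry.Resolution.BertiniAffine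

variable {k : Type u} [Field k] {A : Type u} [CommRing A] [Algebra k A]
variable {ι : Type v} [Fintype ι] (u : ι → A)

set_option synthInstance.maxHeartbeats 80000 in
set_option maxHeartbeats 1600000 in
/-- **The dimension count with a base curve.** Let `A` be regular of finite type over the
algebraically closed field `k`, `𝔭` a prime with `dim A/𝔭 ≤ 1` (the base curve `Σ = V(𝔭)`; that the
`uⱼ` vanish on `Σ` is not needed for the count), `t ↦ s_t mod 𝔪²` surjective onto `A/𝔪²` at closed
points off `Σ` and of rank `≥ 2` at closed points of `Σ`. Then a prime `𝔔` of the incidence ring `B`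
all of whose closed points `(t, 𝔪)`
are bad (`s_t ∈ 𝔪²`) does not lie over the generic point of the parameter space: `𝔔 ∩ k[a] ≠ 0`
(stated on representatives: some non-zero `g ∈ k[a]` maps into `𝔔`).
If `V(𝔔)` has a closed point off `Σ` this is Hartshorne's count at that point
(`dim B/𝔔 ≤ ht 𝔪 + (|ι| - dim A_𝔪 - 1) = |ι| - 1`); if all closed points of `V(𝔔)` lie on `Σ` then
`𝔭A[a] ⊆ 𝔔̃` (Jacobson) and Matsumura 15.1 for `A/𝔭 → A[a]/𝔔̃` gives
`dim A[a]/𝔔̃ ≤ dim A/𝔭 + (|ι| - 2) ≤ |ι| - 1`; but `k[a] ↪ A[a]/𝔔̃` forces `dim ≥ |ι|`.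
[cite: Hartshorne1977, II.8.18 (proof)] -/
theorem under_paramRing_ne_bot_baseCurve [IsAlgClosed k] [IsRegularRing A] [Algebra.FiniteType k A]
    (𝔭 : Ideal A) [𝔭.IsPrime] (hdim : ringKrullDim (A ⧸ 𝔭) ≤ 1)
    (hoff : ∀ 𝔪 : Ideal A, 𝔪.IsMaximal → ¬ 𝔭 ≤ 𝔪 →
      Function.Surjective (linCombQuotSq (k := k) u 𝔪))
    (hon : ∀ 𝔪 : Ideal A, 𝔪.IsMaximal → 𝔭 ≤ 𝔪 →
      2 ≤ Module.finrank k (LinearMap.range (linCombQuotSq (k := k) u 𝔪)))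
    (𝔔 : Ideal (Inc u)) [𝔔.IsPrime]
    (hBad : ∀ (t : ι → k) (𝔪 : Ideal A) [𝔪.IsMaximal],
      linComb u t ∈ 𝔪 → 𝔔 ≤ pointIdeal u t 𝔪 → linComb u t ∈ 𝔪 ^ 2) :
    ∃ g : MvPolynomial ι k, g ≠ 0 ∧
      Ideal.Quotient.mk (Ideal.span {univComb u}) (MvPolynomial.map (algebraMap k A) g) ∈ 𝔔 := by
  classical
  letI : Algebra (MvPolynomial ι k) (MvPolynomial ι A) := MvPolynomial.algebraMvPolynomial
  by_contra hex
  let R := MvPolynomial ι k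
  have h0 : 𝔔.under R = ⊥ := by
    refine (Submodule.eq_bot_iff _).2 fun g hg => ?_
    by_contra hg0
    refine hex ⟨g, hg0, ?_⟩
    rw [Ideal.under_def, Ideal.mem_comap, algebraMap_paramRing_inc, MvPolynomial.algebraMap_def] at hg
    exact hg
  let At := MvPolynomial ι A
  let mkF := Ideal.Quotient.mk (Ideal.span {univComb u})
  haveI : IsNoetherianRing A := inferInstance
  haveI : IsJacobsonRing A := isJacobsonRing_of_finiteType (A := k)
  haveI : IsJacobsonRing At := inferInstance
  set 𝔔t : Ideal At := 𝔔.comap mkF with h𝔔tdef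
  haveI : 𝔔t.IsPrime := Ideal.comap_isPrime _ _
  have hF𝔔t : Ideal.span {univComb u} ≤ 𝔔t := fun x hx => by
    rw [h𝔔tdef, Ideal.mem_comap, Ideal.Quotient.eq_zero_iff_mem.2 hx]
    exact zero_mem _
  have hmap𝔔t : 𝔔t.map mkF = 𝔔 := by
    rw [h𝔔tdef, Ideal.map_comap_of_surjective _ Ideal.Quotient.mk_surjective]
  have h0t : 𝔔t.under R = ⊥ := by
    rw [Ideal.under_def, h𝔔tdef, Ideal.comap_comap]
    exact h0
  -- (lower bound) `|ι| ≤ dim At/𝔔̃` since `k[a] ↪ At/𝔔̃`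
  have hlow : ((Nat.card ι : ℕ∞) : WithBot ℕ∞) ≤ ringKrullDim (At ⧸ 𝔔t) := by
    let φ : R →ₐ[k] At ⧸ 𝔔t := (Ideal.Quotient.mkₐ k 𝔔t).comp (IsScalarTower.toAlgHom k R At)
    have hφ : Function.Injective φ := by
      rw [injective_iff_map_eq_zero]
      intro p hp
      have hp' : Ideal.Quotient.mk 𝔔t (algebraMap R At p) = 0 := hp
      have : p ∈ 𝔔t.under R := by
        rw [Ideal.under_def, Ideal.mem_comap]
        exact Ideal.Quotient.eq_zero_iff_mem.1 hp'
      rwa [h0t, Ideal.mem_bot] at this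
    have h := Literature.RingTheory.KrullDimension.ringKrullDim_le_of_injective (F := k)
      (A := At ⧸ 𝔔t) (B := MvPolynomial ι k) φ hφ
    rwa [MvPolynomial.ringKrullDim_of_isNoetherianRing, ringKrullDim_eq_zero_of_field k,
      zero_add] at h
  -- closed points of `V(𝔔̃)` are `𝔪'.comap (evalPoly t')` with `(t', 𝔪')` bad
  have hclosed : ∀ 𝔐t : Ideal At, 𝔐t.IsMaximal → 𝔔t ≤ 𝔐t →
      ∃ (t' : ι → k) (𝔪' : Ideal A), 𝔪'.IsMaximal ∧ linComb u t' ∈ 𝔪' ^ 2 ∧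
        𝔐t = 𝔪'.comap (evalPoly (A := A) t').toRingHom := by
    intro 𝔐t h𝔐t h𝔔𝔐t
    have hF𝔐t : Ideal.span {univComb u} ≤ 𝔐t := hF𝔔t.trans h𝔔𝔐t
    have h𝔐' : (𝔐t.map mkF).IsMaximal := by
      refine (Ideal.map_eq_top_or_isMaximal_of_surjective _ Ideal.Quotient.mk_surjective
        h𝔐t).resolve_left fun h => ?_
      have h' := congrArg (Ideal.comap mkF) h
      rw [Ideal.comap_map_of_surjective _ Ideal.Quotient.mk_surjective, Ideal.comap_top,
        ← RingHom.ker_eq_comap_bot, Ideal.mk_ker, sup_eq_left.2 hF𝔐t] at h'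
      exact h𝔐t.ne_top h'
    haveI := h𝔐'
    have hcomap : 𝔐t = (𝔐t.map mkF).comap mkF := by
      rw [Ideal.comap_map_of_surjective _ Ideal.Quotient.mk_surjective, ← RingHom.ker_eq_comap_bot,
        Ideal.mk_ker, sup_eq_left.2 hF𝔐t]
    obtain ⟨t', hst', heq⟩ := exists_eq_pointIdeal (k := k) u (𝔐t.map mkF)
    haveI : ((𝔐t.map mkF).under A).IsMaximal :=
      isMaximal_under_of_isMaximal' (K := k) (T := A) (𝔐t.map mkF)
    have h𝔔le : 𝔔 ≤ pointIdeal u t' ((𝔐t.map mkF).under A) := by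
      rw [← heq, ← hmap𝔔t]; exact Ideal.map_mono h𝔔𝔐t
    refine ⟨t', (𝔐t.map mkF).under A, inferInstance, hBad t' _ hst' h𝔔le, ?_⟩
    rw [← comap_mk_pointIdeal u hst', ← heq]
    exact hcomap
  -- the closed point `P = 𝔐̃ ⧸ 𝔔̃` of the affine domain `At ⧸ 𝔔̃`: `dim At/𝔔̃ = ht P`, and `P ∩ A = 𝔪`
  have hpoint : ∀ (𝔐t : Ideal At) (h𝔐tmax : 𝔐t.IsMaximal) (h𝔔𝔐t : 𝔔t ≤ 𝔐t)
      (𝔪 : Ideal A) [𝔪.IsMaximal] (t : ι → k)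
      (h𝔐teq : 𝔐t = 𝔪.comap (evalPoly (A := A) t).toRingHom),
      (𝔐t.map (Ideal.Quotient.mk 𝔔t)).IsMaximal ∧
      (𝔐t.map (Ideal.Quotient.mk 𝔔t)).under A = 𝔪 ∧
      ringKrullDim (At ⧸ 𝔔t) = (((𝔐t.map (Ideal.Quotient.mk 𝔔t)).height : ℕ∞) : WithBot ℕ∞) ∧
      RingHom.ker (Ideal.Quotient.factor (le_sup_left : 𝔔t ≤ 𝔔t ⊔ 𝔪.map (C : A →+* At))) =
        𝔪.map (algebraMap A (At ⧸ 𝔔t)) ∧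
      (𝔐t.map (Ideal.Quotient.mk 𝔔t)).map
          (Ideal.Quotient.factor (le_sup_left : 𝔔t ≤ 𝔔t ⊔ 𝔪.map (C : A →+* At))) =
        𝔐t.map (Ideal.Quotient.mk (𝔔t ⊔ 𝔪.map (C : A →+* At))) := by
    intro 𝔐t h𝔐tmax h𝔔𝔐t 𝔪 _ t h𝔐teq
    set P : Ideal (At ⧸ 𝔔t) := 𝔐t.map (Ideal.Quotient.mk 𝔔t) with hPdef
    haveI hPmax : P.IsMaximal := by
      refine (Ideal.map_eq_top_or_isMaximal_of_surjective _ Ideal.Quotient.mk_surjective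
        h𝔐tmax).resolve_left fun h => ?_
      have h' := congrArg (Ideal.comap (Ideal.Quotient.mk 𝔔t)) h
      rw [Ideal.comap_map_of_surjective _ Ideal.Quotient.mk_surjective, Ideal.comap_top,
        ← RingHom.ker_eq_comap_bot, Ideal.mk_ker, sup_eq_left.2 h𝔔𝔐t] at h'
      exact h𝔐tmax.ne_top h'
    have hPunder : P.under A = 𝔪 := by
      rw [Ideal.under_def, IsScalarTower.algebraMap_eq A At (At ⧸ 𝔔t), ← Ideal.comap_comap,
        Ideal.Quotient.algebraMap_eq, hPdef,
        Ideal.comap_map_of_surjective _ Ideal.Quotient.mk_surjective, ← RingHom.ker_eq_comap_bot,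
        Ideal.mk_ker, sup_eq_left.2 h𝔔𝔐t, h𝔐teq, Ideal.comap_comap, MvPolynomial.algebraMap_eq]
      have : (evalPoly (A := A) t).toRingHom.comp C = RingHom.id A := by ext a; simp
      rw [this, Ideal.comap_id]
    have hU1 : ringKrullDim (At ⧸ 𝔔t) = ((P.height : ℕ∞) : WithBot ℕ∞) := by
      have h := Literature.RingTheory.KrullDimension.ringKrullDim_quotient_add_height k P
      rw [ringKrullDim_quotient_isMaximal P, zero_add] at h
      exact h.symm
    set K₂ : Ideal At := 𝔔t ⊔ 𝔪.map (C : A →+* At) with hK₂def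
    have h𝔔K₂ : 𝔔t ≤ K₂ := le_sup_left
    let g : At ⧸ 𝔔t →+* At ⧸ K₂ := Ideal.Quotient.factor h𝔔K₂
    have hgker : RingHom.ker g = 𝔪.map (algebraMap A (At ⧸ 𝔔t)) := by
      have h1 : RingHom.ker g = K₂.map (Ideal.Quotient.mk 𝔔t) := by
        refine Ideal.comap_injective_of_surjective (Ideal.Quotient.mk 𝔔t) Ideal.Quotient.mk_surjective ?_
        rw [RingHom.comap_ker, Ideal.comap_map_of_surjective _ Ideal.Quotient.mk_surjective,
          ← RingHom.ker_eq_comap_bot, Ideal.mk_ker, sup_eq_left.2 h𝔔K₂]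
        change RingHom.ker ((Ideal.Quotient.factor h𝔔K₂).comp (Ideal.Quotient.mk 𝔔t)) = K₂
        rw [Ideal.Quotient.factor_comp_mk, Ideal.mk_ker]
      rw [h1, hK₂def, Ideal.map_sup, (Ideal.map_eq_bot_iff_le_ker _).2 (by rw [Ideal.mk_ker]),
        bot_sup_eq, Ideal.map_map, IsScalarTower.algebraMap_eq A At (At ⧸ 𝔔t),
        Ideal.Quotient.algebraMap_eq, MvPolynomial.algebraMap_eq]
    have hPg : P.map g = 𝔐t.map (Ideal.Quotient.mk K₂) := by
      rw [hPdef, Ideal.map_map]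
      change 𝔐t.map ((Ideal.Quotient.factor h𝔔K₂).comp (Ideal.Quotient.mk 𝔔t)) = _
      rw [Ideal.Quotient.factor_comp_mk]
    exact ⟨hPmax, hPunder, hU1, hgker, hPg⟩
  -- CASE SPLIT: is there a bad closed point of `V(𝔔̃)` off the base curve?
  by_cases hcase : ∃ (𝔐t : Ideal At) (t : ι → k) (𝔪 : Ideal A), 𝔐t.IsMaximal ∧ 𝔔t ≤ 𝔐t ∧
      𝔪.IsMaximal ∧ linComb u t ∈ 𝔪 ^ 2 ∧ 𝔐t = 𝔪.comap (evalPoly (A := A) t).toRingHom ∧ ¬ 𝔭 ≤ 𝔪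
  · -- Case A: Hartshorne's count at a closed point off `Σ`
    obtain ⟨𝔐t, t, 𝔪, h𝔐tmax, h𝔔𝔐t, h𝔪max, hst2, h𝔐teq, h𝔭𝔪⟩ := hcase
    haveI := h𝔪max
    haveI := h𝔐tmax
    obtain ⟨hPmax, hPunder, hU1, hgker, hPg⟩ := hpoint 𝔐t h𝔐tmax h𝔔𝔐t 𝔪 t h𝔐teq
    set P : Ideal (At ⧸ 𝔔t) := 𝔐t.map (Ideal.Quotient.mk 𝔔t) with hPdef
    haveI := hPmax
    haveI : P.LiesOver 𝔪 := ⟨hPunder.symm⟩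
    -- `dim_k A/𝔪² = n + 1`, `n = ht 𝔪`
    let A𝔪 := Localization.AtPrime 𝔪
    haveI : IsRegularLocalRing A𝔪 := inferInstance
    obtain ⟨n, hn'⟩ := exists_ringKrullDim_eq_natCast A𝔪
    have hn : 𝔪.height = n := by
      have h := IsLocalization.AtPrime.ringKrullDim_eq_height 𝔪 A𝔪
      rw [hn'] at h
      exact_mod_cast h.symm
    have hsurj := hoff 𝔪 inferInstance h𝔭𝔪
    haveI : Module.Finite k (A ⧸ 𝔪 ^ 2) := Module.Finite.of_surjective (linCombQuotSq u 𝔪) hsurj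
    have hfr : Module.finrank k (LinearMap.range (linCombQuotSq (k := k) u 𝔪)) = n + 1 := by
      rw [LinearMap.range_eq_top.2 hsurj, finrank_top]
      exact finrank_quotient_sq 𝔪 hn
    -- the fibre count and Matsumura 15.1 for `A → At/𝔔̃`
    have hfib := height_map_mk_fibre_add_finrank_le u 𝔔t hclosed 𝔐t h𝔐tmax h𝔔𝔐t hst2 h𝔐teq
    rw [hfr] at hfib
    have hU2 : P.height ≤ 𝔪.height +
        (𝔐t.map (Ideal.Quotient.mk (𝔔t ⊔ 𝔪.map (C : A →+* At)))).height := by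
      rw [← hPg]
      exact height_le_height_add_height_map 𝔪 P _ (Ideal.Quotient.factor_surjective _) hgker
    -- the count: `|ι| ≤ ht P ≤ n + (|ι| - (n + 1))`
    have h3 : (Nat.card ι : ℕ∞) ≤ P.height := by
      have h := hlow
      rw [hU1] at h
      exact_mod_cast h
    rw [Nat.card_eq_fintype_card] at h3
    rw [hn] at hU2
    generalize (𝔐t.map (Ideal.Quotient.mk (𝔔t ⊔ 𝔪.map (C : A →+* At)))).height = a at hfib hU2
    generalize P.height = b at h3 hU2
    induction a using ENat.recTopCoe with
    | top => exact absurd hfib (by simp)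
    | coe a =>
      induction b using ENat.recTopCoe with
      | top =>
        have : ((n : ℕ∞) + (a : ℕ∞)) = ⊤ := top_le_iff.mp hU2
        exact absurd this (by simp)
      | coe b =>
        have h5 : Fintype.card ι ≤ b := by exact_mod_cast h3
        have h6 : b ≤ n + a := by exact_mod_cast hU2
        have h7 : a + (n + 1) ≤ Fintype.card ι := by exact_mod_cast hfib
        omega
  · -- Case B: every closed point of `V(𝔔̃)` lies on the base curve; then `𝔭A[a] ⊆ 𝔔̃`
    push Not at hcase
    have hSig : ∀ (𝔐t : Ideal At), 𝔐t.IsMaximal → 𝔔t ≤ 𝔐t →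
        ∃ (t : ι → k) (𝔪 : Ideal A), 𝔪.IsMaximal ∧ linComb u t ∈ 𝔪 ^ 2 ∧
          𝔐t = 𝔪.comap (evalPoly (A := A) t).toRingHom ∧ 𝔭 ≤ 𝔪 := by
      intro 𝔐t h𝔐t h𝔔𝔐t
      obtain ⟨t, 𝔪, h𝔪, hst2, h𝔐teq⟩ := hclosed 𝔐t h𝔐t h𝔔𝔐t
      exact ⟨t, 𝔪, h𝔪, hst2, h𝔐teq, hcase 𝔐t t 𝔪 h𝔐t h𝔔𝔐t h𝔪 hst2 h𝔐teq⟩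
    have h𝔭𝔔t : 𝔭.map (C : A →+* At) ≤ 𝔔t := by
      have hrad : 𝔔t.IsRadical := (inferInstance : 𝔔t.IsPrime).isRadical
      rw [← (‹IsJacobsonRing At›).out hrad, Ideal.jacobson, Ideal.map_le_iff_le_comap]
      intro p hp
      rw [Ideal.mem_comap]
      refine Submodule.mem_sInf.2 fun M hM => ?_
      obtain ⟨t, 𝔪, h𝔪, -, hMeq, h𝔭𝔪⟩ := hSig M hM.2 hM.1
      rw [hMeq, Ideal.mem_comap]
      simpa using h𝔭𝔪 hp
    -- a closed point above `𝔔̃`, necessarily on `Σ`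
    obtain ⟨𝔐t, h𝔐tmax, h𝔔𝔐t⟩ := Ideal.exists_le_maximal 𝔔t (Ideal.IsPrime.ne_top inferInstance)
    obtain ⟨t, 𝔪, h𝔪max, hst2, h𝔐teq, h𝔭𝔪⟩ := hSig 𝔐t h𝔐tmax h𝔔𝔐t
    haveI := h𝔪max
    haveI := h𝔐tmax
    obtain ⟨hPmax, hPunder, hU1, hgker, hPg⟩ := hpoint 𝔐t h𝔐tmax h𝔔𝔐t 𝔪 t h𝔐teq
    set P : Ideal (At ⧸ 𝔔t) := 𝔐t.map (Ideal.Quotient.mk 𝔔t) with hPdef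
    haveI := hPmax
    -- the algebra `A/𝔭 → At/𝔔̃`
    have hvan : ∀ a : A, a ∈ 𝔭 → algebraMap A (At ⧸ 𝔔t) a = 0 := by
      intro a ha
      rw [IsScalarTower.algebraMap_apply A At (At ⧸ 𝔔t), Ideal.Quotient.algebraMap_eq,
        Ideal.Quotient.eq_zero_iff_mem, MvPolynomial.algebraMap_eq]
      exact h𝔭𝔔t (Ideal.mem_map_of_mem _ ha)
    let ψ : A ⧸ 𝔭 →+* At ⧸ 𝔔t := Ideal.Quotient.lift 𝔭 (algebraMap A (At ⧸ 𝔔t)) hvan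
    letI algψ : Algebra (A ⧸ 𝔭) (At ⧸ 𝔔t) := ψ.toAlgebra
    have hψ : algebraMap (A ⧸ 𝔭) (At ⧸ 𝔔t) = ψ := rfl
    set 𝔪b : Ideal (A ⧸ 𝔭) := 𝔪.map (Ideal.Quotient.mk 𝔭) with h𝔪bdef
    haveI h𝔪bmax : 𝔪b.IsMaximal := by
      refine (Ideal.map_eq_top_or_isMaximal_of_surjective _ Ideal.Quotient.mk_surjective
        h𝔪max).resolve_left fun h => ?_
      have h' := congrArg (Ideal.comap (Ideal.Quotient.mk 𝔭)) h
      rw [Ideal.comap_map_of_surjective _ Ideal.Quotient.mk_surjective, Ideal.comap_top,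
        ← RingHom.ker_eq_comap_bot, Ideal.mk_ker, sup_eq_left.2 h𝔭𝔪] at h'
      exact h𝔪max.ne_top h'
    haveI : P.LiesOver 𝔪b := by
      refine ⟨?_⟩
      rw [Ideal.under_def, hψ]
      have h1 : (P.comap ψ).comap (Ideal.Quotient.mk 𝔭) = 𝔪 := by
        rw [Ideal.comap_comap, Ideal.Quotient.lift_comp_mk]
        exact hPunder
      rw [← Ideal.map_comap_of_surjective (Ideal.Quotient.mk 𝔭) Ideal.Quotient.mk_surjective
        (P.comap ψ), h1]
    have hgker' : RingHom.ker (Ideal.Quotient.factor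
        (le_sup_left : 𝔔t ≤ 𝔔t ⊔ 𝔪.map (C : A →+* At))) = 𝔪b.map (algebraMap (A ⧸ 𝔭) (At ⧸ 𝔔t)) := by
      rw [hgker, hψ, h𝔪bdef, Ideal.map_map, Ideal.Quotient.lift_comp_mk]
    -- `ht 𝔪̄ ≤ dim A/𝔭 ≤ 1`
    have h𝔪b1 : 𝔪b.height ≤ 1 := by
      have h := (Ideal.height_le_ringKrullDim_of_ne_top h𝔪bmax.ne_top).trans hdim
      exact_mod_cast h
    -- the fibre count and Matsumura 15.1 for `A/𝔭 → At/𝔔̃`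
    have hfib := height_map_mk_fibre_add_finrank_le u 𝔔t hclosed 𝔐t h𝔐tmax h𝔔𝔐t hst2 h𝔐teq
    have hr := hon 𝔪 inferInstance h𝔭𝔪
    have hU2 : P.height ≤ 𝔪b.height +
        (𝔐t.map (Ideal.Quotient.mk (𝔔t ⊔ 𝔪.map (C : A →+* At)))).height := by
      rw [← hPg]
      exact height_le_height_add_height_map 𝔪b P _ (Ideal.Quotient.factor_surjective _) hgker'
    have h3 : (Nat.card ι : ℕ∞) ≤ P.height := by
      have h := hlow
      rw [hU1] at h
      exact_mod_cast h
    rw [Nat.card_eq_fintype_card] at h3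
    generalize (𝔐t.map (Ideal.Quotient.mk (𝔔t ⊔ 𝔪.map (C : A →+* At)))).height = a at hfib hU2
    generalize P.height = b at h3 hU2
    generalize 𝔪b.height = c at h𝔪b1 hU2
    generalize Module.finrank k (LinearMap.range (linCombQuotSq (k := k) u 𝔪)) = r at hfib hr
    induction c using ENat.recTopCoe with
    | top => exact absurd h𝔪b1 (by simp)
    | coe c =>
      induction a using ENat.recTopCoe with
      | top => exact absurd hfib (by simp)
      | coe a =>
        induction b using ENat.recTopCoe with
        | top =>
          have : ((c : ℕ∞) + (a : ℕ∞)) = ⊤ := top_le_iff.mp hU2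
          exact absurd this (by simp)
        | coe b =>
          have h5 : Fintype.card ι ≤ b := by exact_mod_cast h3
          have h6 : b ≤ c + a := by exact_mod_cast hU2
          have h7 : a + r ≤ Fintype.card ι := by exact_mod_cast hfib
          have h8 : c ≤ 1 := by exact_mod_cast h𝔪b1
          omega

end Summit.ResolutionOfSingularities.ResolutionOfSingularities.Cruxes.EquisingularLift.StrataSplit

end
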